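import Literature.NumberTheory.NumberFields.NumberFieldIsomorphismPProofs
import HarnessLib

/-!
# Number-field isomorphism in `P`: the two vendored forms of the fact are equivalent

Continues `NumberFieldIsomorphismPProofs.lean`, which proved that the decode-based form
`Literature.Computability.Complexity.lenstra_numberFieldIso_mem_P` (`NFIsoLang ∈ P`: pairs of ANY
strings reading as monic irreducible `p, q ∈ ℤ[X]` with `ℚ[X]/(p) ≅ ℚ[X]/(q)`) of the theorem
"number-field isomorphism is decidable in polynomial time" (A. K. Lenstra 1983, Thm. (3.7);
Landau 1985; H. W. Lenstra 1992, §2.9) implies the exact-code form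
`Literature.NumberTheory.NumberFields.nfIso_mem_P` (`nfIsoLang ∈ P`). Here is the converse,
`lenstra_numberFieldIso_mem_P_of_nfIso_mem_P`, whence **`nfIso_mem_P_iff`: the two named facts
are equivalent** (a discharge of either discharges both), and the same for the companion facts
on irreducibility (`lll_monicIrreducible_mem_P_iff : lll_monicIrreducible_mem_P ↔
monicIrredLang ∈ P`, so `nfIso_mem_P → lll_monicIrreducible_mem_P`).

The one ingredient is the **canonical re-encoding of a string as a polynomial code in polynomial
time**, `canonPolyF ∈ FP` with `canonPolyF u = encodingIntPoly.encode (decPoly u)`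
(`canonPolyF_eq`): after the tree's integer-list canonicalisation `CanonCode.canonListFn
canonIntFn = encode ∘ decode` (`CanonicalCodes.lean`) the item list `l` must still be replaced by
the ascending coefficient list of the polynomial `∑ lᵢ Xⁱ` it denotes, i.e. its trailing zero
entries dropped (`List.rdropWhile`) and the empty result read as `[0]`
(`coeffsAsc_ofCoeffsAsc_eq_trim`). This is done by list folds in the `FP` string algebra
(`Brick.foldFn`, `ListFoldBricks.lean`): `trimStep` keeps an accumulator `⟨pending zero items,
output items⟩`, appending a zero item to the pending block and flushing the block into the output
at each nonzero item (`foldl_trimStep`), `finalizeF` replaces an empty output by the one-item list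
`[code 0]`, and `countItemsF` rebuilds the unary length header. Then
`NFIsoLang = {w | w = ⟨fst w, snd w⟩} ∩ ⟨canonPolyF ∘ fst, canonPolyF ∘ snd⟩⁻¹' nfIsoLang`
(`NFIsoLang_eq_inter_preimage`) and `MonicIrreducibleLang = canonPolyF ⁻¹' monicIrredLang`.

## References

* A. K. Lenstra, *Factoring polynomials over algebraic number fields*, EUROCAL '83, LNCS 162
  (1983) 245–254 = Math. Centrum report IW 213/82, Thm. (3.7). [Lenstra1983]
* S. Landau, *Factoring polynomials over algebraic number fields*, SIAM J. Comput. 14 (1985)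
  184–195. [Landau1985]
* A. K. Lenstra, H. W. Lenstra Jr., L. Lovász, *Factoring polynomials with rational
  coefficients*, Math. Ann. 261 (1982) 515–534, Thm. (3.6). [LenstraLenstraLovasz1982]
* S. Arora, B. Barak, *Computational Complexity: A Modern Approach*, CUP 2009, §0.1, §1.3.
  [AroraBarak2009]
-/

open Polynomial

namespace Literature.NumberTheory.NumberFields

open _root_.Computability Literature.Computability.Complexity
  Literature.Computability.Complexity.Brick

/-! ### Trailing zeros of a coefficient list -/

/-- Appending entries that are all zero does not change the polynomial. [folklore] -/
theorem ofCoeffsAsc_append_of_forall_eq_zero (r t : List ℤ) (ht : ∀ x ∈ t, x = 0) :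
    ofCoeffsAsc (r ++ t) = ofCoeffsAsc r := by
  ext i
  rw [coeff_ofCoeffsAsc, coeff_ofCoeffsAsc, List.getD_eq_getElem?_getD, List.getD_eq_getElem?_getD]
  by_cases hi : i < r.length
  · rw [List.getElem?_append_left hi]
  · rw [List.getElem?_append_right (not_lt.1 hi), List.getElem?_eq_none (not_lt.1 hi),
      Option.getD_none]
    cases h : t[i - r.length]? with
    | none => rfl
    | some x => exact ht x (List.mem_of_getElem? h)

/-- Dropping the trailing zero entries does not change the polynomial. [folklore] -/
theorem ofCoeffsAsc_rdropWhile (l : List ℤ) :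
    ofCoeffsAsc (l.rdropWhile (· == 0)) = ofCoeffsAsc l := by
  conv_rhs => rw [← List.rdropWhile_append_rtakeWhile (p := (· == 0)) (l := l)]
  rw [ofCoeffsAsc_append_of_forall_eq_zero]
  intro x hx
  simpa using List.mem_rtakeWhile_imp hx

/-- `ofCoeffsAsc [] = 0`. [folklore] -/
@[simp] theorem ofCoeffsAsc_nil : ofCoeffsAsc [] = 0 := by
  simp [ofCoeffsAsc]

/-- **The ascending coefficient list of `∑ lᵢ Xⁱ` is `l` with its trailing zeros dropped**, read
as `[0]` when nothing is left. [folklore] -/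
theorem coeffsAsc_ofCoeffsAsc_eq_trim (l : List ℤ) :
    coeffsAsc (ofCoeffsAsc l) =
      if l.rdropWhile (· == 0) = [] then [0] else l.rdropWhile (· == 0) := by
  rw [← ofCoeffsAsc_rdropWhile]
  split_ifs with h
  · rw [h, ofCoeffsAsc_nil, coeffsAsc_zero]
  · have hlast := List.rdropWhile_last_not (p := (· == 0)) (l := l) h
    refine coeffsAsc_ofCoeffsAsc (List.getLast?_eq_some_getLast h) ?_
    simpa using hlast

/-! ### The trimming fold -/

/-- The code of the integer `0`. [folklore] -/
def codeZero : List Bool := encodingIntBool.encode 0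

/-- The zero test of the trimming fold on `⟨w, ⟨item, acc⟩⟩`: is the item the code of `0`?
[folklore] -/
noncomputable def isZeroItem : List Bool → List Bool := eqPairFn ∘ fanoutFn (nthF 1) fun _ => codeZero

/-- `isZeroItem ∈ FP`. [folklore] -/
theorem isZeroItem_mem_FP : isZeroItem ∈ FP :=
  comp_mem_FP eqPairFn_mem_FP (fanoutFn_mem_FP (nthF_mem_FP 1) (const_mem_FP _))

/-- `isZeroItem` is one-bit. [folklore] -/
theorem oneBit_isZeroItem : OneBit isZeroItem := fun v =>
  ⟨_, by rw [isZeroItem, Function.comp_apply, fanoutFn_apply, eqPairFn_boolPair]⟩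

/-- Value of the zero test. [folklore] -/
theorem isZeroItem_apply (w a acc : List Bool) :
    isZeroItem (boolPair w (boolPair a acc)) = [decide (a = codeZero)] := by
  rw [isZeroItem, Function.comp_apply, fanoutFn_apply, eqPairFn_boolPair]
  simp

/-- The snoc of the current item onto a block: on `⟨w, ⟨a, ⟨pend, out⟩⟩⟩`, `pend ++ ⟨a, ε⟩`.
[folklore] -/
noncomputable def snocPendF : List Bool → List Bool :=
  appF ∘ fanoutFn (nthF 2) (fanoutFn (nthF 1) fun _ => [])

/-- `snocPendF ∈ FP`. [folklore] -/
theorem snocPendF_mem_FP : snocPendF ∈ FP :=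
  comp_mem_FP appF_mem_FP (fanoutFn_mem_FP (nthF_mem_FP 2) (fanoutFn_mem_FP (nthF_mem_FP 1)
    (const_mem_FP _)))

/-- Value of `snocPendF` on every input. [folklore] -/
theorem snocPendF_eq (v : List Bool) : snocPendF v = nthF 2 v ++ boolPair (nthF 1 v) [] := by
  simp [snocPendF]

/-- **One step of the trimming fold** on `⟨w, ⟨a, ⟨pend, out⟩⟩⟩`: a zero item is appended to the
pending block (`⟨pend ++ ⟨a, ε⟩, out⟩`), a nonzero item flushes the block into the output
(`⟨ε, out ++ pend ++ ⟨a, ε⟩⟩`). [Arora–Barak 2009, §1.3 (bounded loops)]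
[cite: AroraBarak2009, §1.3] -/
noncomputable def trimStep : List Bool → List Bool :=
  iteFn isZeroItem (fanoutFn snocPendF (sndPow 2))
    (fanoutFn (fun _ => []) (appF ∘ fanoutFn (sndPow 2) snocPendF))

/-- `trimStep ∈ FP`. [folklore] -/
theorem trimStep_mem_FP : trimStep ∈ FP :=
  iteFn_mem_FP isZeroItem_mem_FP (fanoutFn_mem_FP snocPendF_mem_FP (sndPow_mem_FP 2))
    (fanoutFn_mem_FP (const_mem_FP _)
      (comp_mem_FP appF_mem_FP (fanoutFn_mem_FP (sndPow_mem_FP 2) snocPendF_mem_FP)))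

/-- Value of `trimStep` on a zero item. [folklore] -/
theorem trimStep_zero (w pend out : List Bool) :
    trimStep (boolPair w (boolPair codeZero (boolPair pend out))) =
      boolPair (pend ++ boolPair codeZero []) out := by
  rw [trimStep, iteFn_apply_true (by rw [isZeroItem_apply]; simp)]
  simp [snocPendF_eq, nthF, sndPow]

/-- Value of `trimStep` on a nonzero item. [folklore] -/
theorem trimStep_ne_zero (w pend out : List Bool) {a : List Bool} (ha : a ≠ codeZero) :
    trimStep (boolPair w (boolPair a (boolPair pend out))) =
      boolPair [] (out ++ (pend ++ boolPair a [])) := by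
  rw [trimStep, iteFn_apply_false (by rw [isZeroItem_apply]; simp [ha])]
  simp [snocPendF_eq, nthF, sndPow]

/-- **Growth of the trimming step** (on every input): `FoldGrowth 6`. [folklore] -/
theorem foldGrowth_trimStep : FoldGrowth 6 trimStep := by
  intro v
  have hacc := length_fstF_sndF_le (sndF (sndF v))
  have e1 : nthF 1 v = fstF (sndF v) := rfl
  have e2 : nthF 2 v = fstF (sndF (sndF v)) := rfl
  have e3 : sndPow 2 v = sndF (sndF (sndF v)) := rfl
  rw [trimStep, iteFn_of_oneBit oneBit_isZeroItem]
  split_ifs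
  · rw [fanoutFn_apply, length_boolPair, snocPendF_eq, List.length_append, length_boolPair, e1, e2,
      e3]
    simp only [List.length_nil]
    omega
  · rw [fanoutFn_apply, length_boolPair, Function.comp_apply, appF, fanoutFn_apply, fstF_boolPair,
      sndF_boolPair, snocPendF_eq, List.length_append, List.length_append, length_boolPair, e1, e2,
      e3]
    simp only [List.length_nil]
    omega

/-- **The trimming fold on genuine items**: from `⟨ε, ε⟩`, folding `trimStep` over the codes of
an integer list `l` ends with the pending block holding the codes of the trailing zeros of `l`
and the output holding the codes of `l` with its trailing zeros dropped. [folklore] -/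
theorem foldl_trimStep (w : List Bool) (l : List ℤ) :
    (l.map encodingIntBool.encode).foldl (fun acc a => trimStep (boolPair w (boolPair a acc)))
        (boolPair [] []) =
      boolPair (encList ((l.rtakeWhile (· == 0)).map encodingIntBool.encode))
        (encList ((l.rdropWhile (· == 0)).map encodingIntBool.encode)) := by
  -- `encList` turns concatenation into concatenation (the tree has this in several machine
  -- files, e.g. `FarCertMachine.encList_append_singleton`, none of which is worth importing here)
  have encList_append : ∀ L₁ L₂ : List (List Bool),
      encList (L₁ ++ L₂) = encList L₁ ++ encList L₂ := by
    intro L₁ L₂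
    induction L₁ with
    | nil => rfl
    | cons b L ih => rw [List.cons_append, encList_cons, encList_cons, ih]; simp [boolPair]
  have encList_append_singleton : ∀ (L : List (List Bool)) (b : List Bool),
      encList (L ++ [b]) = encList L ++ boolPair b [] := fun L b => by
    rw [encList_append]; rfl
  induction l using List.reverseRecOn with
  | nil => rfl
  | append_singleton l a ih =>
    rw [List.map_append, List.foldl_append, ih, List.map_singleton, List.foldl_cons, List.foldl_nil]
    by_cases ha : a = 0
    · subst ha
      rw [List.rtakeWhile_concat_pos _ l _ (by simp), List.rdropWhile_concat_pos _ l _ (by simp),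
        show encodingIntBool.encode (0 : ℤ) = codeZero from rfl, trimStep_zero, List.map_append,
        List.map_singleton, encList_append_singleton]
      rfl
    · have hne : encodingIntBool.encode a ≠ codeZero := fun h =>
        ha (encodingIntBool.encode_injective h)
      rw [List.rtakeWhile_concat_neg _ l _ (by simpa using ha),
        List.rdropWhile_concat_neg _ l _ (by simpa using ha), trimStep_ne_zero _ _ _ hne]
      conv_rhs => rw [← List.rdropWhile_append_rtakeWhile (p := (· == 0)) (l := l)]
      rw [List.map_append, List.map_append, List.map_singleton, encList_append, encList_append,
        List.map_nil, encList_nil, List.append_assoc]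
      rfl

/-- **`trimItemsF`**: the trimming fold over the items of the coded list in the second component,
started from `⟨ε, ε⟩`. [cite: AroraBarak2009, §1.3] -/
noncomputable def trimItemsF : List Bool → List Bool := foldFn trimStep fun _ => boolPair [] []

/-- `trimItemsF ∈ FP`. [folklore] -/
theorem trimItemsF_mem_FP : trimItemsF ∈ FP :=
  foldFn_mem_FP trimStep_mem_FP (const_mem_FP _) foldGrowth_trimStep

/-- Value of `trimItemsF` on a genuine integer-list code. [folklore] -/
theorem trimItemsF_listBool_encode (l : List ℤ) :
    trimItemsF (encodingIntBool.listBool.encode l) =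
      boolPair (encList ((l.rtakeWhile (· == 0)).map encodingIntBool.encode))
        (encList ((l.rdropWhile (· == 0)).map encodingIntBool.encode)) := by
  rw [listBool_encode_eq_encList, trimItemsF, foldFn_boolPair, decNil_encList, foldl_trimStep]

/-! ### Finalisation, header, and the canonical polynomial code -/

/-- Replace an empty item string by the one-item list `[code 0]`. [folklore] -/
noncomputable def finalizeF : List Bool → List Bool := iteFn isNilFn (fun _ => boolPair codeZero []) id

/-- `finalizeF ∈ FP`. [folklore] -/
theorem finalizeF_mem_FP : finalizeF ∈ FP :=
  iteFn_mem_FP isNilFn_mem_FP (const_mem_FP _) (PolyTimeComputable.id _)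

/-- Value of `finalizeF` on a coded list of integer codes: the codes of `l`, or of `[0]` if `l`
is empty. [folklore] -/
theorem finalizeF_encList (l : List ℤ) :
    finalizeF (encList (l.map encodingIntBool.encode)) =
      encList ((if l = [] then [0] else l).map encodingIntBool.encode) := by
  cases l with
  | nil =>
    rw [finalizeF, iteFn_apply_true (by simp [isNilFn]), if_pos rfl]
    rfl
  | cons a l =>
    rw [finalizeF, iteFn_apply_false (by simp [isNilFn, encList_cons, boolPair])]
    simp

/-- **`countItemsF`**: the number of items of the coded list in the second component, in unary
(a fold appending one `1` per item). [cite: AroraBarak2009, §1.3] -/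
noncomputable def countItemsF : List Bool → List Bool :=
  foldFn (appF ∘ fanoutFn (sndPow 1) fun _ => [true]) fun _ => []

/-- `countItemsF ∈ FP`. [folklore] -/
theorem countItemsF_mem_FP : countItemsF ∈ FP := by
  refine foldFn_mem_FP (comp_mem_FP appF_mem_FP (fanoutFn_mem_FP (sndPow_mem_FP 1)
    (const_mem_FP _))) (const_mem_FP _) (c := 1) ?_
  intro v
  have e : sndPow 1 v = sndF (sndF v) := rfl
  rw [Function.comp_apply, appF, fanoutFn_apply, fstF_boolPair, sndF_boolPair, List.length_append,
    e]
  simp only [List.length_singleton]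
  omega

/-- Value of `countItemsF` on a coded list: `1^{#items}`. [folklore] -/
theorem countItemsF_boolPair_encList (x : List Bool) (L : List (List Bool)) :
    countItemsF (boolPair x (encList L)) = List.replicate L.length true := by
  rw [countItemsF, foldFn_boolPair, decNil_encList]
  simp only [Function.comp_apply, fanoutFn_apply, appF_boolPair, sndPow_succ_boolPair,
    sndPow_zero_boolPair]
  have key : ∀ (acc : List Bool) (L' : List (List Bool)),
      L'.foldl (fun acc _ => acc ++ [true]) acc = acc ++ List.replicate L'.length true := by
    intro acc L'
    induction L' generalizing acc with
    | nil => simp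
    | cons b L' ih =>
      rw [List.foldl_cons, ih, List.length_cons, List.replicate_succ, List.append_assoc]
      rfl
  rw [key, List.nil_append]

/-- **`canonPolyF`, the canonical polynomial code of a string**: canonicalise the integer-list
code, trim and finalise its items, and rebuild the unary header. [cite: AroraBarak2009, §0.1] -/
noncomputable def canonPolyF : List Bool → List Bool :=
  fanoutFn (countItemsF ∘ fanoutFn (fun _ => []) (finalizeF ∘ sndF ∘ trimItemsF))
      (finalizeF ∘ sndF ∘ trimItemsF) ∘
    CanonCode.canonListFn CanonCode.canonIntFn

/-- `canonPolyF ∈ FP`. [folklore] -/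
theorem canonPolyF_mem_FP : canonPolyF ∈ FP := by
  have hG : finalizeF ∘ sndF ∘ trimItemsF ∈ FP :=
    comp_mem_FP finalizeF_mem_FP (comp_mem_FP sndF_mem_FP trimItemsF_mem_FP)
  exact comp_mem_FP
    (fanoutFn_mem_FP (comp_mem_FP countItemsF_mem_FP (fanoutFn_mem_FP (const_mem_FP _) hG)) hG)
    (CanonCode.canonListFn_mem_FP CanonCode.canonIntFn_mem_FP CanonCode.length_canonIntFn_le)

/-- **`canonPolyF` re-encodes**: `canonPolyF u` is the code of the polynomial read off `u`.
[folklore] -/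
theorem canonPolyF_eq (u : List Bool) : canonPolyF u = encodingIntPoly.encode (decPoly u) := by
  -- Mathlib's unary numeral is a block of `1`s (as in `TautCertificates.lean`, not imported here)
  have unaryEncodeNat_eq_replicate : ∀ n : ℕ, unaryEncodeNat n = List.replicate n true := by
    intro n
    induction n with
    | zero => rfl
    | succ n ih => rw [unaryEncodeNat, ih, List.replicate_succ]
  set l := decIntList u with hl
  set T : List ℤ := if l.rdropWhile (· == 0) = [] then [0] else l.rdropWhile (· == 0) with hT
  have hG : (finalizeF ∘ sndF ∘ trimItemsF) (encodingIntBool.listBool.encode l) =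
      encList (T.map encodingIntBool.encode) := by
    rw [Function.comp_apply, Function.comp_apply, trimItemsF_listBool_encode, sndF_boolPair,
      finalizeF_encList]
  have hcode : encodingIntPoly.encode (decPoly u) = encodingIntBool.listBool.encode T := by
    change encodingIntBool.listBool.encode (coeffsAsc (ofCoeffsAsc l)) = _
    rw [coeffsAsc_ofCoeffsAsc_eq_trim]
  rw [canonPolyF, Function.comp_apply, canonListFn_canonIntFn_eq, ← hl, fanoutFn_apply,
    Function.comp_apply, fanoutFn_apply, hG, countItemsF_boolPair_encList, List.length_map, hcode,
    listBool_encode_eq_encList, unaryEncodeNat_eq_replicate]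

/-- `canonPolyF` fixes the code of a polynomial. [folklore] -/
theorem canonPolyF_encode (p : ℤ[X]) : canonPolyF (encodingIntPoly.encode p) = encodingIntPoly.encode p := by
  rw [canonPolyF_eq, decPoly_encode]

/-! ### The decode-based languages as preimages of the exact-code languages -/

/-- The pair of canonical polynomial codes of the two components. [folklore] -/
noncomputable def pairCanonPolyF : List Bool → List Bool :=
  fanoutFn (canonPolyF ∘ fstF) (canonPolyF ∘ sndF)

/-- `pairCanonPolyF ∈ FP`. [folklore] -/
theorem pairCanonPolyF_mem_FP : pairCanonPolyF ∈ FP :=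
  fanoutFn_mem_FP (comp_mem_FP canonPolyF_mem_FP fstF_mem_FP)
    (comp_mem_FP canonPolyF_mem_FP sndF_mem_FP)

/-- **`NFIsoLang` from `nfIsoLang`**: a string lies in `NFIsoLang` iff it is a genuine pair code
whose pair of canonical polynomial codes lies in `nfIsoLang`. [folklore] -/
theorem NFIsoLang_eq_inter_preimage :
    NFIsoLang = ({z | z = boolPair (fstF z) (sndF z)} : Language Bool) ⊓
      (pairCanonPolyF ⁻¹' nfIsoLang : Language Bool) := by
  ext w
  change w ∈ NFIsoLang ↔ w = boolPair (fstF w) (sndF w) ∧ pairCanonPolyF w ∈ nfIsoLang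
  simp only [pairCanonPolyF, fanoutFn_apply, Function.comp_apply, canonPolyF_eq]
  constructor
  · rintro ⟨u, v, p, q, rfl, hu, hv, hpm, hpi, hqm, hqi, hiso⟩
    rw [fstF_boolPair, sndF_boolPair, ← eq_decPoly_of_polyDecode_eq hu,
      ← eq_decPoly_of_polyDecode_eq hv]
    exact ⟨rfl, (boolPair_encode_mem_nfIsoLang_iff p q).2 ⟨⟨hpm, hpi⟩, ⟨hqm, hqi⟩, hiso⟩⟩
  · rintro ⟨hw, hmem⟩
    obtain ⟨⟨hpm, hpi⟩, ⟨hqm, hqi⟩, hiso⟩ := (boolPair_encode_mem_nfIsoLang_iff _ _).1 hmem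
    exact ⟨fstF w, sndF w, _, _, hw, polyDecode_eq_some _, polyDecode_eq_some _, hpm, hpi, hqm,
      hqi, hiso⟩

/-- **`MonicIrreducibleLang` from `monicIrredLang`**: the preimage under `canonPolyF`. [folklore] -/
theorem MonicIrreducibleLang_eq_preimage :
    MonicIrreducibleLang = (canonPolyF ⁻¹' monicIrredLang : Language Bool) := by
  ext u
  change u ∈ MonicIrreducibleLang ↔ canonPolyF u ∈ monicIrredLang
  rw [canonPolyF_eq, encode_mem_monicIrredLang_iff]
  constructor
  · rintro ⟨p, hu, hpm, hpi⟩
    rw [← eq_decPoly_of_polyDecode_eq hu]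
    exact ⟨hpm, hpi⟩
  · rintro ⟨hpm, hpi⟩
    exact ⟨_, polyDecode_eq_some u, hpm, hpi⟩

/-! ### The equivalences -/

/-- **`nfIso_mem_P → lenstra_numberFieldIso_mem_P`**: the exact-code form of "number-field
isomorphism is in `P`" implies the decode-based form (re-encode both components canonically,
`pairCanonPolyF ∈ FP`, and use `P`'s closure under `FP`-preimages and intersection).
[cite: Lenstra1983, Thm. (3.7)] -/
theorem lenstra_numberFieldIso_mem_P_of_nfIso_mem_P (h : nfIso_mem_P) :
    lenstra_numberFieldIso_mem_P := by
  unfold lenstra_numberFieldIso_mem_P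
  rw [NFIsoLang_eq_inter_preimage]
  exact inter_mem_P setOf_eq_boolPair_mem_P (preimage_mem_P h pairCanonPolyF_mem_FP)

/-- **The two vendored forms of "number-field isomorphism is in `P`" are equivalent.**
[cite: Lenstra1983, Thm. (3.7)] -/
theorem nfIso_mem_P_iff : nfIso_mem_P ↔ lenstra_numberFieldIso_mem_P :=
  ⟨lenstra_numberFieldIso_mem_P_of_nfIso_mem_P, nfIso_mem_P_of_lenstra_numberFieldIso_mem_P⟩

/-- **The two vendored forms of "irreducibility of monic integer polynomials is in `P`" are
equivalent.** [cite: LenstraLenstraLovasz1982, Thm. (3.6)] -/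
theorem lll_monicIrreducible_mem_P_iff : lll_monicIrreducible_mem_P ↔ monicIrredLang ∈ Classes.P := by
  refine ⟨monicIrredLang_mem_P_of_lll_monicIrreducible_mem_P, fun h => ?_⟩
  unfold lll_monicIrreducible_mem_P
  rw [MonicIrreducibleLang_eq_preimage]
  exact preimage_mem_P h canonPolyF_mem_FP

/-- **`nfIso_mem_P → lll_monicIrreducible_mem_P`**: the number-field isomorphism fact (either
form) yields the decode-based irreducibility fact, through the diagonal reduction
`monicIrredLang_mem_P`. [cite: LenstraLenstraLovasz1982, Thm. (3.6)] -/
theorem lll_monicIrreducible_mem_P_of_nfIso_mem_P (h : nfIso_mem_P) : lll_monicIrreducible_mem_P :=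
  lll_monicIrreducible_mem_P_iff.2 (monicIrredLang_mem_P h)

end Literature.NumberTheory.NumberFields
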